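/-
COR-CM (cell pub-hodgecm2, stage 2 of the Hodge ladder) — count-neutral KERNEL COMBINATORICS «the sheared dihedral family», part XIX: the normal forms
of the `s`-translated equator squares (seat prover-pub-hodgecm2-b23-g52-0, binder prover b23, gen 52; claim «SYLOW TRANSFER XII + THE SHEARED DIHEDRAL
FAMILY», HOME/INBOX.md l.23708).  PORT of the `t`-half of gen 44ʼs `Census/QuarticInversionGenerators.lean` (this lineage) to the involution `s`
(mask `bS = {1,3}`; parts VI/XI/XII), the `e`/`y`-half (`ΦL`, `cB`, `kS`, `kY`, `nf_S`, `nf_yS`, `kOf_sqFace`) BY NAME: bookkeeping definitions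
with bodies (the sign vectors `kSh`, `kShY`) + theorems; no `decide` beyond closed identities in `Bool`/`Fin 4`, no certificate, no named fact,
no geometry, no `sorry`.  `Interfaces.lean` (C1), every E term, B01, `Transposition/*`, `PortJoin/*`, `D2Bridge/*` untouched.
HONEST FRAMING: `HC_CM` is NOT proved, here or anywhere in the tree; nothing here is a period, a count of record or a headline.
-/
import Summits.HodgeConjecture.CorCM.Census.ShearedDihedralOrbit
import Summits.HodgeConjecture.CorCM.Census.QuarticInversionGenerators

/-!
# The sheared dihedral family, XIX: the generators of the closing lattice of the slice column

CONTENT (`|A|` odd `≥ 3`, square class `ζ`).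
* §1 The normal form of a member of the `s`-orbit span lies in the value module `valModS` once all binomials do (`nf_mem_of_binS`).
* §2 **Columns of `s`-translates**: `kOf j (s·v) = ± kOf (σT j) v` with the sign `−` exactly on the mask `bS = {1,3}` (`kOf_translS`); the
  normal form of `s·v` (`nf_translS`).
* §3 **The `s`-translated equator squares**: `nf (s·S_b) = ΦL (kSh, cB b ∘ pS)` and `nf (s·y·S_b) = ΦL (kShY ζ, cB b ∘ pY ζ ∘ pS)`
  (`nf_sS`, `nf_syS`) — with gen 44ʼs `nf_S`, `nf_yS` the twelve generators that part XX checks against the relations.  All [folklore].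

## References
* [Pohlmann1968] H. Pohlmann, Algebraic cycles on abelian varieties of complex multiplication type, Ann. of Math. 88 (1968), Thm 1.
-/

namespace Summit.HodgeConjecture.CorCM.Census.ShearedDihedral

open Summit.HodgeConjecture.CorCM.Census.QuarticInversion
open Finset
open Summit.HodgeConjecture.CorCM.Census.OddSliceFacesModel

noncomputable section

variable (A : Type) [AddCommGroup A] [Fintype A] [DecidableEq A]

/-! ## §1 Normal forms in the value module -/

/-- **The normal form of a member of the `s`-orbit span lies in the value module** once every slot binomial does. [folklore] -/
theorem nf_mem_of_binS (hA : Odd (Fintype.card A)) (ζ : ZMod 2) {F : Set (Ty₄ A → ℤ)} (hF : F ⊆ hodge₄ A)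
    (hbin : ∀ j h h' u, binVec A j h h' u ∈ valModS A ζ F) {v : Ty₄ A → ℤ} (hv : v ∈ orbSpanS A ζ F) :
    nf A v ∈ valModS A ζ F := by
  have hle : binSpan A ≤ valModS A ζ F := Submodule.span_le.mpr (by rintro _ ⟨j, h, h', u, rfl⟩; exact hbin j h h' u)
  have h1 := Avec_mem_valModS A ζ F hv
  have h2 := hle (Avec_sub_nf_mem A hA (orbSpanS_le_hodge₄ A ζ hF hv))
  have := (valModS A ζ F).sub_mem h1 h2
  rwa [sub_sub_cancel] at this

/-! ## §2 Columns of `s`-translates -/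

/-- **`fnl (wUp j u) (s·v) = ± fnl (wUp (σT j) u) v`**, the sign `−` exactly on the mask `bS`. [folklore] -/
theorem fnl_wUp_translS (hA : Odd (Fintype.card A)) (j : Fin 4) (u : A) (v : Ty₄ A → ℤ) :
    fnl A (wUp A j u) (translS A v) = (if bS j then -1 else 1) * fnl A (wUp A (σT j) u) v := by
  rw [fnl_translS]
  cases hb : bS j
  · have hw : (wUp A j u ∘ twS A) = wUp A (σT j) u := by funext Θ; simp only [Function.comp, wUp_twS A hA, hb]; rfl
    rw [hw]; simp
  · have hw : (wUp A j u ∘ twS A) = (wUp A (σT j) u ∘ conj₄ A) := by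
      funext Θ; simp only [Function.comp, wUp_twS A hA, hb, if_true]
    rw [hw, fnl_comp_conj₄]; simp

/-- `kOf j (s·v) = ± kOf (σT j) v`. [folklore] -/
theorem kOf_translS (hA : Odd (Fintype.card A)) (j : Fin 4) (v : Ty₄ A → ℤ) :
    kOf A j (translS A v) = (if bS j then -1 else 1) * kOf A (σT j) v := by
  unfold kOf; rw [fnl_wUp_translS A hA]

/-- **The normal form of `s·v`.** [folklore] -/
theorem nf_translS (hA : Odd (Fintype.card A)) (v : Ty₄ A → ℤ) :
    nf A (translS A v) = ΦL A (fun j => (if bS j then -1 else 1) * kOf A (σT j) v, fun η => fnl A (wC A (pS η)) v) := by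
  rw [nf_eq_ΦL]
  congr 1
  ext j
  · exact kOf_translS A hA j v
  · exact fnl_wC_translS A hA _ v

/-! ## §3 The `s`-translated equator squares -/

/-- The column vector of `s·S_b`. [folklore] -/
def kSh : Fin 4 → ℤ := fun j => (if bS j then -1 else 1) * kS (σT j)
/-- The column vector of `s·y·S_b`. [folklore] -/
def kShY (ζ : ZMod 2) : Fin 4 → ℤ := fun j => (if bS j then -1 else 1) * kY ζ (σT j)

section Family
variable {P : Finset A} {u₁ u₂ : A}

/-- **`nf (s·S_b) = ΦL (kSh, cB b ∘ pS)`.** [folklore] -/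
theorem nf_sS (hA : Odd (Fintype.card A)) (h1 : u₁ ∉ P) (h2 : u₂ ∉ P) (h12 : u₁ ≠ u₂) (hP : P.card + 1 = Fintype.card A / 2)
    (b : Fin 4 → Bool) : nf A (translS A (sqFace A P u₁ u₂ b)) = ΦL A (kSh, fun η => cB b (pS η)) := by
  rw [nf_translS A hA]
  congr 1
  ext j
  · show (if bS j then -1 else 1) * kOf A (σT j) (sqFace A P u₁ u₂ b) = (if bS j then -1 else 1) * kS (σT j)
    rw [kOf_sqFace A hA h1 h2 h12 hP]; rfl
  · exact fnl_wC_sqFace_eq_cB A hA h1 h2 h12 hP b _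

/-- **`nf (s·y·S_b) = ΦL (kShY ζ, cB b ∘ pY ζ ∘ pS)`.** [folklore] -/
theorem nf_syS (hA : Odd (Fintype.card A)) (ζ : ZMod 2) (h1 : u₁ ∉ P) (h2 : u₂ ∉ P) (h12 : u₁ ≠ u₂)
    (hP : P.card + 1 = Fintype.card A / 2) (b : Fin 4 → Bool) :
    nf A (translS A (translY A ζ (sqFace A P u₁ u₂ b))) = ΦL A (kShY ζ, fun η => cB b (pY ζ (pS η))) := by
  rw [nf_translS A hA]
  congr 1
  ext j
  · show (if bS j then -1 else 1) * kOf A (σT j) (translY A ζ (sqFace A P u₁ u₂ b)) = (if bS j then -1 else 1) * kY ζ (σT j)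
    rw [kOf_translY A hA, kOf_sqFace A hA h1 h2 h12 hP]; rfl
  · exact fnl_wC_translY A hA ζ _ _ |>.trans (fnl_wC_sqFace_eq_cB A hA h1 h2 h12 hP b _)

end Family

end

end Summit.HodgeConjecture.CorCM.Census.ShearedDihedral
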